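import Literature.AnabelianGeometry.EtaleTheta.Discharge.Sec2GalExtensionCocycles

/-!
# [EtTh] Prop 1.5 over the §1 setting: conjugation by GEOMETRIC elements on the theta cohomology
# classes (inputs of the bi-theta clause of Prop 2.14 (iii) / Cor 2.16 for the §1 model)

Mochizuki, *The Étale Theta Function and its Frobenioid-theoretic Manifestations* [EtTh],
Publ. RIMS 45 (2009), §1 Prop 1.5 (PRIMS PDF p.23) and §2 Prop 2.14 (iii) (p.50), Cor 2.16 (pp.53–54)
(locators `p.N` = PDF pages; bib key `MochizukiEtTh2009`). PROOF-ONLY companion (no `def`) of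
`ThetaCohomology.lean` (seat abc-iut-L2-t1) and `Discharge/Sec2ThetaOrbitClasses.lean` (seat abc-iut-L2-t10);
seat abc-iut-L2-t2 (§2), node `EtTh:Cor2.16` for the §1 model.

For a GEOMETRIC element `x ∈ Δ^tp_X ⊆ Π^tp_X` (`aug x = 1`) the printed structure of `(Δ^tp_X)^Θ`
(`Δ^Θ_X = Δ_X/[Δ_X,[Δ_X,Δ_X]]`, a central extension of the abelian `Δ^ell_X` by `Δ_Θ ≅ Ẑ(1)`, p.12 — root
fields `ker_thetaToEll_central`, `ker_toEll`) gives, on the real continuous `H¹`: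

* `toTheta_conj_commutator_mem_deltaTheta` — commutators of `(Δ^tp_X)^Θ` lie in `Δ_Θ`;
* `conj_eq_self_of_mem_Fdd2` — conjugation by `x̄` acts TRIVIALLY on `F̈² = Ker(H¹((Π^tp_Ÿ)^Θ) →
  H¹((Δ^tp_Ÿ)^Θ))` (the classes "from `G_K̈`": `x̄` centralises `Δ_Θ` and moves elements of `(Π^tp_Ÿ)^Θ`
  only within their `(Δ^tp_Ÿ)^Θ`-coset);
* `conj_logUdd_div_mem_Fdd2` — `x̄·log(Ü) − log(Ü) ∈ F̈²` given Prop 1.5 (ii)'s `log(Ü) ∈ F̈¹` ("`Gal(Y/X)`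
  maps `Ü` to a `K^×`-multiple of `Ü`": a class killing `Δ_Θ` is moved by `x̄` only through
  commutators, which lie in `Δ_Θ`);
* `secondDiff_conj_etaDd_eq` — the SECOND DIFFERENCE of the orbit `i ↦ (x^i σ)·η̈^Θ` of the étale theta
  class under the powers of `x` is `V^{2a}` for a class `V ∈ F̈²` fixed by `x̄` (`a = ` the image of `x` in
  `Z`), from Prop 1.5 (iii) applied ONCE (at `σ⁻¹xσ`) — the quadratic term `−(a²/2)·log(q_X)` and the
  unit term of Prop 1.5 (iii) cancel in a second difference, leaving `(x̄·log(Ü) − log(Ü))^{−2a}`.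

These are the class-level inputs of `Discharge/Sec2Cor216OfModel.lean`. HONEST FRAMING: conditional on
abc-iut-L2-t1's named facts `Prop15ii`, `Prop15iii` exactly as the printed proofs of Prop 2.14 / Cor 2.16
are on Prop 1.5; nothing else asserted; no side taken on [IUTchIII] Cor 3.12.
-/

noncomputable section

namespace Literature.AnabelianGeometry.EtaleTheta

open Literature.AnabelianGeometry.SemiGraphs
open scoped IsMulCommutative

namespace ThetaSetting

variable {p : ℕ} [Fact p.Prime] {D : ThetaSetting p}

/-! ## Group theory of `(Δ^tp_X)^Θ`: commutators and the centre -/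

/-- **Commutators of `(Δ^tp_X)^Θ` lie in `Δ_Θ`** (`Δ^Θ_X ↠ Δ^ell_X = Δ^ab_X` has kernel `Δ_Θ`, p.12): for
`s, t` in the image of `Δ^tp_X`, `s t s⁻¹ t⁻¹ ∈ Δ_Θ = Ker((Π^tp_X)^Θ ↠ (Π^tp_X)^ell)` — from the root field
`ker_toEll` (`Ker(Π^tp_X ↠ (Π^tp_X)^ell)` is the pull-back of `[Δ_X, Δ_X]⁻`). [cite: MochizukiEtTh2009, §1 p.12] -/
theorem toTheta_conj_commutator_mem_deltaTheta {x y : D.PiTemp} (hx : x ∈ D.DeltaTemp)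
    (hy : y ∈ D.DeltaTemp) :
    D.toTheta x * D.toTheta y * (D.toTheta x)⁻¹ * (D.toTheta y)⁻¹ ∈ D.DeltaTheta := by
  have hx' : D.toHat.toMonoidHom x ∈ D.DeltaHat := by
    have h := hx
    rw [← D.comap_toHat_deltaHat] at h
    exact h
  have hy' : D.toHat.toMonoidHom y ∈ D.DeltaHat := by
    have h := hy
    rw [← D.comap_toHat_deltaHat] at h
    exact h
  have hmem : x * y * x⁻¹ * y⁻¹ ∈ (D.thetaToEll.comp D.toTheta).ker := by
    rw [D.ker_toEll, Subgroup.mem_comap, map_mul, map_mul, map_mul, map_inv, map_inv]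
    have h := Subgroup.commutator_mem_commutator hx' hy'
    rw [commutatorElement_def] at h
    exact Subgroup.le_topologicalClosure _ h
  have h2 : D.toTheta (x * y * x⁻¹ * y⁻¹) ∈ D.DeltaTheta := hmem
  simpa only [map_mul, map_inv] using h2

/-- The same for elements of `(Δ^tp_X)^Θ = ` image of `Δ^tp_X`. [cite: MochizukiEtTh2009, §1 p.12] -/
theorem conj_commutator_mem_deltaTheta {s t : D.GtpTheta} (hs : s ∈ D.DeltaTemp.map D.toTheta)
    (ht : t ∈ D.DeltaTemp.map D.toTheta) : s * t * s⁻¹ * t⁻¹ ∈ D.DeltaTheta := by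
  obtain ⟨x, hx, rfl⟩ := hs
  obtain ⟨y, hy, rfl⟩ := ht
  exact toTheta_conj_commutator_mem_deltaTheta hx hy

/-- `Δ_Θ` acts trivially on itself by conjugation (commutative). [cite: MochizukiEtTh2009, §1 p.12] -/
theorem conjNormal_eq_of_mem_deltaTheta {d : D.GtpTheta} (hd : d ∈ D.DeltaTheta) (e : D.DeltaTheta) :
    MulAut.conjNormal d e = e := by
  apply Subtype.ext
  rw [MulAut.conjNormal_apply, ← D.ker_thetaToEll_comm (e : D.GtpTheta) e.2 d hd, mul_inv_cancel_right]

/-- A continuous cocycle on `(Π^tp_Ÿ)^Θ` whose class lies in `F̈²` VANISHES on `(Δ^tp_Ÿ)^Θ` (its restriction is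
a coboundary, and `(Δ^tp_Ÿ)^Θ ⊆ (Δ^tp_X)^Θ` centralises `Δ_Θ`). [cite: MochizukiEtTh2009, Prop 1.5 (ii) p.23] -/
theorem cocycle_apply_eq_one_of_mem_Fdd2
    (c : contCocycles (MonoidHom.id D.GtpTheta) D.DeltaTheta (D.GtpYdd.map D.toTheta))
    (hc : (QuotientGroup.mk c : D.H1Theta (D.GtpYdd.map D.toTheta)) ∈
      (Fdd2 : Subgroup (D.H1Theta (D.GtpYdd.map D.toTheta))))
    (k : D.GtpYdd.map D.toTheta) (hk : (k : D.GtpTheta) ∈ (D.DtpYddN 1).map D.toTheta) :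
    c.1 k = 1 := by
  have hc' : (QuotientGroup.mk (ContH1.resCocycle (MonoidHom.id D.GtpTheta) D.DeltaTheta
      (Subgroup.map_mono inf_le_left : (D.DtpYddN 1).map D.toTheta ≤ D.GtpYdd.map D.toTheta) c) :
      D.H1Theta ((D.DtpYddN 1).map D.toTheta)) = 1 := hc
  rw [QuotientGroup.eq_one_iff, Subgroup.mem_subgroupOf, mem_contCoboundaries_iff] at hc'
  obtain ⟨a, ha⟩ := hc'
  have h1 := congrFun ha ⟨k, hk⟩
  obtain ⟨δ, hδ, hδk⟩ := hk
  have haug : D.aug.toMonoidHom δ = 1 := (Subgroup.mem_inf.1 hδ).2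
  have h2 : MulAut.conjNormal ((MonoidHom.id D.GtpTheta) ((⟨k, ⟨δ, hδ, hδk⟩⟩ :
      (D.DtpYddN 1).map D.toTheta) : D.GtpTheta)) a = a := by
    rw [MonoidHom.id_apply]
    change MulAut.conjNormal (k : D.GtpTheta) a = a
    rw [← hδk]
    exact conjNormal_eq_of_aug_eq_one haug a
  rw [h2, mul_inv_cancel] at h1
  rw [← h1]
  rfl

/-- **Conjugation by a geometric element acts trivially on `F̈²`**: for `x ∈ Π^tp_X` with `aug x = 1` and
`z ∈ F̈² ⊆ H¹((Π^tp_Ÿ)^Θ, Δ_Θ)`, `x̄·z = z` (`x̄` centralises `Δ_Θ`, and `x̄⁻¹ k̄ x̄ ∈ k̄·(Δ^tp_Ÿ)^Θ` where a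
representative cocycle of `z` vanishes). [cite: MochizukiEtTh2009, Prop 1.5 (ii) p.23] -/
theorem conj_eq_self_of_mem_Fdd2 (hC : D.Compat) {x : D.PiTemp} (hx : D.aug.toMonoidHom x = 1)
    {z : D.H1Theta (D.GtpYdd.map D.toTheta)}
    (hz : z ∈ (Fdd2 : Subgroup (D.H1Theta (D.GtpYdd.map D.toTheta)))) :
    haveI := hC.GtpYddTheta_normal
    ContH1.conj (MonoidHom.id D.GtpTheta) D.DeltaTheta (D.toTheta x) z = z := by
  haveI := hC.GtpYddTheta_normal
  haveI := hC.GtpYdd_normal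
  induction z using QuotientGroup.induction_on with
  | H c =>
    change (QuotientGroup.mk (ContH1.conjCocycle (MonoidHom.id D.GtpTheta) D.DeltaTheta (D.toTheta x) c) :
      D.H1Theta (D.GtpYdd.map D.toTheta)) = QuotientGroup.mk c
    congr 1
    apply Subtype.ext
    funext k
    rw [ContH1.conjCocycle_apply, MonoidHom.id_apply]
    obtain ⟨κ, hκ, hκk⟩ := k.2
    -- `x̄⁻¹ k̄ x̄ = k̄ · d` with `d ∈ (Δ^tp_Ÿ)^Θ`
    have hd : (k : D.GtpTheta)⁻¹ * (D.toTheta x)⁻¹ * k * D.toTheta x ∈ (D.DtpYddN 1).map D.toTheta := by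
      refine ⟨κ⁻¹ * x⁻¹ * κ * x, Subgroup.mem_inf.2 ⟨?_, ?_⟩, ?_⟩
      · change κ⁻¹ * x⁻¹ * κ * x ∈ D.GtpYdd
        have h1 : x⁻¹ * κ * x⁻¹⁻¹ ∈ D.GtpYdd := hC.GtpYdd_normal.conj_mem κ hκ x⁻¹
        rw [inv_inv] at h1
        simpa [mul_assoc] using D.GtpYdd.mul_mem (D.GtpYdd.inv_mem hκ) h1
      · change κ⁻¹ * x⁻¹ * κ * x ∈ D.aug.toMonoidHom.ker
        rw [MonoidHom.mem_ker, map_mul, map_mul, map_mul, map_inv, map_inv, hx, inv_one, mul_one,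
          mul_one, inv_mul_cancel]
      · rw [map_mul, map_mul, map_mul, map_inv, map_inv, hκk]
    have hd' : (k : D.GtpTheta)⁻¹ * (D.toTheta x)⁻¹ * k * D.toTheta x ∈ D.GtpYdd.map D.toTheta :=
      Subgroup.map_mono (inf_le_left : D.DtpYddN 1 ≤ D.GtpYddN 1) hd
    have hsplit : MulAut.conjNormal (D.toTheta x)⁻¹ k = k * ⟨_, hd'⟩ := by
      apply Subtype.ext
      simp only [MulAut.conjNormal_apply, inv_inv, Subgroup.coe_mul]
      group
    rw [hsplit, c.2.2, cocycle_apply_eq_one_of_mem_Fdd2 c hz ⟨_, hd'⟩ hd, map_one, mul_one]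
    exact conjNormal_eq_of_aug_eq_one hx _

namespace EtaleThetaData

variable (E : D.EtaleThetaData)

/-- **`x̄·log(Ü) − log(Ü) ∈ F̈²` for geometric `x`** ("`Gal(Y/X)` maps `Ü` to a `K^×`-multiple of `Ü`",
cf. p.49): `log(Ü) ∈ F̈¹` (Prop 1.5 (ii)) is represented by a cocycle KILLING `Δ_Θ`; for `k̄ ∈ (Δ^tp_Ÿ)^Θ`,
`x̄⁻¹ k̄ x̄ = k̄ · [k̄⁻¹, x̄⁻¹]` with the commutator in `Δ_Θ`, so the conjugate cocycle agrees with the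
original on `(Δ^tp_Ÿ)^Θ`. [cite: MochizukiEtTh2009, Prop 1.5 (ii) p.23] -/
theorem conj_logUdd_div_mem_Fdd2 (hC : D.Compat) (h15ii : Prop15ii E.toKummerData hC) {x : D.PiTemp}
    (hx : D.aug.toMonoidHom x = 1) :
    haveI := hC.GtpYddTheta_normal
    ContH1.conj (MonoidHom.id D.GtpTheta) D.DeltaTheta (D.toTheta x) E.logUdd * E.logUdd⁻¹ ∈
      (Fdd2 : Subgroup (D.H1Theta (D.GtpYdd.map D.toTheta))) := by
  haveI := hC.GtpYddTheta_normal
  haveI := hC.DtpYddTheta_normal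
  obtain ⟨c, hcL⟩ : ∃ c : contCocycles (MonoidHom.id D.GtpTheta) D.DeltaTheta (D.GtpYdd.map D.toTheta),
      (QuotientGroup.mk c : D.H1Theta (D.GtpYdd.map D.toTheta)) = E.logUdd :=
    QuotientGroup.mk_surjective _
  -- `c` kills `Δ_Θ` (`log(Ü) ∈ F̈¹` and `Δ_Θ` acts trivially on itself)
  have hle : D.DeltaTheta ≤ D.GtpYdd.map D.toTheta :=
    hC.deltaTheta_le_DtpYddTheta.trans (Subgroup.map_mono inf_le_left)
  have hF1 : E.logUdd ∈ Fdd1 hC := h15ii.logUdd_mem_Fdd1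
  have hvan : ∀ (d : D.GtpTheta) (hd : d ∈ D.DeltaTheta), c.1 ⟨d, hle hd⟩ = 1 := by
    have h0 : (QuotientGroup.mk (ContH1.resCocycle (MonoidHom.id D.GtpTheta) D.DeltaTheta hle c) :
        D.H1Theta D.DeltaTheta) = 1 := by
      rw [← hcL] at hF1; exact hF1
    rw [QuotientGroup.eq_one_iff, Subgroup.mem_subgroupOf, mem_contCoboundaries_iff] at h0
    obtain ⟨a, ha⟩ := h0
    intro d hd
    have h1 := congrFun ha ⟨d, hd⟩
    rw [MonoidHom.id_apply, conjNormal_eq_of_mem_deltaTheta hd, mul_inv_cancel] at h1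
    rw [← h1]
    rfl
  -- the conjugate cocycle agrees with `c` on `(Δ^tp_Ÿ)^Θ`
  rw [← hcL]
  change ContH1.res (MonoidHom.id D.GtpTheta) D.DeltaTheta _
    (QuotientGroup.mk (ContH1.conjCocycle (MonoidHom.id D.GtpTheta) D.DeltaTheta (D.toTheta x) c * c⁻¹)) = 1
  change (QuotientGroup.mk (ContH1.resCocycle (MonoidHom.id D.GtpTheta) D.DeltaTheta
    (Subgroup.map_mono inf_le_left : (D.DtpYddN 1).map D.toTheta ≤ D.GtpYdd.map D.toTheta)
    (ContH1.conjCocycle (MonoidHom.id D.GtpTheta) D.DeltaTheta (D.toTheta x) c * c⁻¹)) :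
      D.H1Theta ((D.DtpYddN 1).map D.toTheta)) = 1
  rw [QuotientGroup.eq_one_iff, Subgroup.mem_subgroupOf, mem_contCoboundaries_iff]
  refine ⟨1, ?_⟩
  have hle2 : (D.DtpYddN 1).map D.toTheta ≤ D.GtpYdd.map D.toTheta := Subgroup.map_mono inf_le_left
  funext k
  rw [map_one, mul_inv_cancel]
  obtain ⟨δ, hδ, hδk⟩ := k.2
  have hδΔ : δ ∈ D.DeltaTemp := (Subgroup.mem_inf.1 hδ).2
  change (ContH1.conjCocycle (MonoidHom.id D.GtpTheta) D.DeltaTheta (D.toTheta x) c).1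
      ⟨k, hle2 k.2⟩ * (c.1 ⟨k, hle2 k.2⟩)⁻¹ = 1
  rw [mul_inv_eq_one, ContH1.conjCocycle_apply]
  -- `x̄⁻¹ k̄ x̄ = k̄ · comm`, `comm ∈ Δ_Θ`
  have hcomm : (k : D.GtpTheta)⁻¹ * (D.toTheta x)⁻¹ * k * D.toTheta x ∈ D.DeltaTheta := by
    have h := conj_commutator_mem_deltaTheta (D := D) (s := (k : D.GtpTheta)⁻¹) (t := (D.toTheta x)⁻¹)
      ⟨δ⁻¹, D.DeltaTemp.inv_mem hδΔ, by rw [map_inv, hδk]⟩ ⟨x⁻¹, D.DeltaTemp.inv_mem hx, map_inv _ _⟩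
    simpa only [inv_inv] using h
  have hsplit : MulAut.conjNormal (D.toTheta x)⁻¹ (⟨k, hle2 k.2⟩ : D.GtpYdd.map D.toTheta) =
      ⟨k, hle2 k.2⟩ * ⟨_, hle hcomm⟩ := by
    apply Subtype.ext
    simp only [MulAut.conjNormal_apply, inv_inv, Subgroup.coe_mul]
    group
  rw [hsplit, c.2.2, hvan _ hcomm, map_one, mul_one]
  exact conjNormal_eq_of_aug_eq_one hx _

/-- **The second difference of the `⟨x⟩`-orbit of the étale theta class** (for the bi-theta clause of
Prop 2.14 (iii) and Cor 2.16): for `x ∈ Π^tp_X` GEOMETRIC (`aug x = 1`) with image `a` in `Z`, and any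
`σ ∈ Π^tp_X`, there is a class `V ∈ F̈²` with
`((x²σ)·η̈^Θ) · (σ·η̈^Θ) · ((xσ)·η̈^Θ)⁻² = infl(V)^{2a}` in `H¹(Π^tp_Ÿ, Δ_Θ)`. From Prop 1.5 (iii) at
`τ = σ⁻¹xσ` (`x̄·η̈ = η̈ − 2a·log(Ü) − a²·log(q̈) + log(u)`), `x̄·log(Ü) − log(Ü) =: W ∈ F̈²`
(`conj_logUdd_div_mem_Fdd2`) and the triviality of `x̄` on `F̈²`: the second difference is `W^{−2a}`,
transported by `σ̄`. [cite: MochizukiEtTh2009, Prop 1.5 (iii) p.23] -/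
theorem secondDiff_conj_etaDd_eq (hC : D.Compat) (h15 : Prop15iii E hC)
    (h15ii : Prop15ii E.toKummerData hC) {x : D.PiTemp} (hx : D.aug.toMonoidHom x = 1) (σ : D.PiTemp) :
    ∃ V ∈ (Fdd2 : Subgroup (D.H1Theta (D.GtpYdd.map D.toTheta))),
      haveI := hC.GtpYdd_normal
      ContH1.conj D.toTheta D.DeltaTheta (x * x * σ) E.etaDd * ContH1.conj D.toTheta D.DeltaTheta σ E.etaDd *
          (ContH1.conj D.toTheta D.DeltaTheta (x * σ) E.etaDd ^ 2)⁻¹ =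
        D.inflTheta D.GtpYdd V ^ (2 * Multiplicative.toAdd (D.toZ x)) := by
  haveI := hC.GtpYdd_normal
  haveI := hC.GtpYddTheta_normal
  obtain ⟨x', hx', hΦ⟩ := E.exists_lift_conj_eq hC h15
  -- the geometric element `τ = σ⁻¹ x σ`, with the same image `a` in `Z`
  set τ : D.PiTemp := σ⁻¹ * x * σ with hτdef
  have hτaug : D.aug.toMonoidHom τ = 1 := by
    rw [hτdef, map_mul, map_mul, map_inv, hx, mul_one, inv_mul_cancel]
  set a : ℤ := Multiplicative.toAdd (D.toZ x) with ha
  have hτZ : Multiplicative.toAdd (D.toZ τ) = a := by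
    rw [hτdef, map_mul D.toZ, map_mul D.toZ, map_inv D.toZ, toAdd_mul, toAdd_mul, toAdd_inv, ha]; ring
  obtain ⟨u, -, hu⟩ := hΦ τ
  rw [hτZ] at hu
  set L := E.logUdd with hL
  set Q := E.kumYdd (E.toKddHat D.qddUnit) with hQ
  set U := E.kumYdd (E.toKddHat u) with hU
  set cτ : D.H1Theta (D.GtpYdd.map D.toTheta) →* D.H1Theta (D.GtpYdd.map D.toTheta) :=
    ContH1.conj (MonoidHom.id D.GtpTheta) D.DeltaTheta (D.toTheta τ) with hcτ
  -- `W := τ̄·L · L⁻¹ ∈ F̈²`, fixed by `τ̄`; `Q`, `U ∈ F̈²` fixed by `τ̄`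
  set W := cτ L * L⁻¹ with hW
  have hWmem : W ∈ (Fdd2 : Subgroup (D.H1Theta (D.GtpYdd.map D.toTheta))) :=
    E.conj_logUdd_div_mem_Fdd2 hC h15ii hτaug
  have hQmem : Q ∈ (Fdd2 : Subgroup (D.H1Theta (D.GtpYdd.map D.toTheta))) := by
    rw [hQ, h15ii.Fdd2_eq]; exact ⟨_, rfl⟩
  have hUmem : U ∈ (Fdd2 : Subgroup (D.H1Theta (D.GtpYdd.map D.toTheta))) := by
    rw [hU, h15ii.Fdd2_eq]; exact ⟨_, rfl⟩
  have hcW : cτ W = W := conj_eq_self_of_mem_Fdd2 hC hτaug hWmem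
  have hcQ : cτ Q = Q := conj_eq_self_of_mem_Fdd2 hC hτaug hQmem
  have hcU : cτ U = U := conj_eq_self_of_mem_Fdd2 hC hτaug hUmem
  have hcL : cτ L = L * W := by rw [hW, mul_comm L (cτ L * L⁻¹), inv_mul_cancel_right]
  -- the second difference at `τ`
  have h1 : cτ x' = x' * (L ^ (-(2 * a)) * Q ^ (-(a * a)) * U) := hu
  have h2 : cτ (cτ x') = x' * (L ^ (-(2 * a)) * Q ^ (-(a * a)) * U) *
      ((L * W) ^ (-(2 * a)) * Q ^ (-(a * a)) * U) := by
    rw [h1, map_mul, h1, map_mul, map_mul, map_zpow, map_zpow, hcL, hcQ, hcU]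
  have hSD : cτ (cτ x') * x' * (cτ x' ^ 2)⁻¹ = W⁻¹ ^ (2 * a) := by
    rw [h2, h1]
    apply (Additive.ofMul : D.H1Theta (D.GtpYdd.map D.toTheta) ≃ _).injective
    simp only [ofMul_mul, ofMul_inv, ofMul_zpow, ofMul_pow, mul_zpow, inv_zpow']
    module
  -- transport by `σ̄`: `σ̄ τ̄ = (xσ)̄`, `σ̄ τ̄² = (x²σ)̄`
  set cσ : D.H1Theta (D.GtpYdd.map D.toTheta) →* D.H1Theta (D.GtpYdd.map D.toTheta) :=
    ContH1.conj (MonoidHom.id D.GtpTheta) D.DeltaTheta (D.toTheta σ) with hcσ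
  have hστ : D.toTheta σ * D.toTheta τ = D.toTheta (x * σ) := by
    rw [← map_mul, hτdef]; congr 1; group
  have hσττ : D.toTheta (x * σ) * D.toTheta τ = D.toTheta (x * x * σ) := by
    rw [← map_mul, hτdef]; congr 1; group
  refine ⟨cσ W⁻¹, Fdd2_conj_mem hC _ (inv_mem hWmem), ?_⟩
  have key : cσ (cτ (cτ x') * x' * (cτ x' ^ 2)⁻¹) = cσ W⁻¹ ^ (2 * a) := by rw [hSD, map_zpow]
  rw [map_mul, map_mul, map_inv, map_pow, hcσ, hcτ, ← ContH1.conj_mul_apply, ← ContH1.conj_mul_apply,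
    ← ContH1.conj_mul_apply, hστ, hσττ] at key
  -- inflate to `Π^tp_Ÿ`
  have e0 : ContH1.conj D.toTheta D.DeltaTheta σ E.etaDd =
      D.inflTheta D.GtpYdd (ContH1.conj (MonoidHom.id D.GtpTheta) D.DeltaTheta (D.toTheta σ) x') := by
    rw [← hx']
    exact (ContH1.infl_conj (H₀ := D.GtpYdd) (H' := D.GtpYdd.map D.toTheta)
      (hψ := D.continuous_toTheta) le_rfl σ x').symm
  have e1 : ContH1.conj D.toTheta D.DeltaTheta (x * σ) E.etaDd =
      D.inflTheta D.GtpYdd (ContH1.conj (MonoidHom.id D.GtpTheta) D.DeltaTheta (D.toTheta (x * σ)) x') := by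
    rw [← hx']
    exact (ContH1.infl_conj (H₀ := D.GtpYdd) (H' := D.GtpYdd.map D.toTheta)
      (hψ := D.continuous_toTheta) le_rfl (x * σ) x').symm
  have e2 : ContH1.conj D.toTheta D.DeltaTheta (x * x * σ) E.etaDd =
      D.inflTheta D.GtpYdd
        (ContH1.conj (MonoidHom.id D.GtpTheta) D.DeltaTheta (D.toTheta (x * x * σ)) x') := by
    rw [← hx']
    exact (ContH1.infl_conj (H₀ := D.GtpYdd) (H' := D.GtpYdd.map D.toTheta)
      (hψ := D.continuous_toTheta) le_rfl (x * x * σ) x').symm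
  rw [e0, e1, e2, ← map_pow, ← map_mul, ← map_inv, ← map_mul, key, map_zpow, hcσ]

end EtaleThetaData

end ThetaSetting

end Literature.AnabelianGeometry.EtaleTheta

end
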